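/- Copyright: the b2b-balaban cell (near-miss cell 7), T⁴-continuum fan-out; row NE7b ROUND-2 swarm, seat
t4-ne7b-formalise-leaf-05 (gen 6) (row S12 «ASSEMBLY», owner repair row S12j «THRESHOLD-PAID MULTIPLICITY», piece (e);
ruling R-OWNER-23-10, journal l.15837; INTENT l.15910).  Released under the licence of the surrounding project. -/
import Summits.QuantumFields.BalabanUV.T4Continuum.Support.HistoryFlow

/-!
# History flow: the profile level `P ≤ p₀(g_K(s))` along tuned runs, FROM THE COUPLING WINDOW

Summits-side support leaf of the T⁴-continuum cell (rung (B)+1 on a FINITE torus only; NOT infinite volume, NOT the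
mass gap, NOT the Clay statement; NOT a proof of the spine estimate NE7b).  Row S12 of the swarm claim table
`t4/b2b-balaban-t4-ne7b-p1/LEAVES-NE7b.md`, owner repair row S12j «THRESHOLD-PAID MULTIPLICITY» (R-OWNER-23-10), piece
(e).  [folklore] bookkeeping over tree declarations (`HistoryFlow`, `Setup.p0Profile`, `B14.FlowIneq26`); nothing is
quoted from print and nothing printed is asserted; no `[cite:]` tag; no `def`; no `Prop`-valued fact minted (c1).

WHY.  Finding F-leaf08g7-1 (journal l.15793, booked by R-OWNER-23-10): END OF RECORD v3 homes the class-linear placement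
entropy of the slot multiplicity on the O(1) slack AT THE PROFILE FLOOR `p₀ ≥ 1`, which demands
`½·O.γ₀·O.A₁² > 8·8710^d` of the printed constants — vacuous for O(1) constants.  The repair S12j re-homes it on the
profile AT A LEVEL `P`: the socket chain displays ONE new binder
    `hP : ∀ K ≥ K₀, ∀ s ≤ K, P ≤ p0Profile C.A₀ C.p₀ ((D.C ⟨K, F.m, g₀ K⟩).flow.g s)`
together with `hθJ : ΘJ d sS θc + 8·2^d·log(2d+1) ≤ θ·P`, and in the pinned ∕ apex form `hP` is to be DISCHARGED from the
smallness of the couplings along Bałaban's asymptotically free runs.  THIS FILE is that discharge, stand-alone and BY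
NAME, so that the S12j socket∕junction files (leaf-10 g7) keep `hP` displayed verbatim and the S12i pinned∕apex files
(leaf-02 g9) plug it with one term.

WHAT.
* §1 WINDOW ROUTE (needs ONLY tuning `D.Tuned γ g g₀`, whose `InInterval` clause says `0 < g_K(s) ≤ γ` for all
  `s ≤ K`): `le_log_inv_sq_along_of_window` — `γ ≤ e^{−x∕2}` ⇒ `x ≤ log g_K(s)⁻²` for all `K`, `s ≤ K`;
  `profile_ge_along_of_window` — hence `A₀·x^{p₀} ≤ p₀(g_K(s))` (`0 ≤ A₀`, `0 ≤ x`).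
* §2 RENORMALISED-COUPLING ROUTE (needs the flow side the ENDs already hold: β-box bounds ⇐ BetaPertH, `γ ≤ γ₀`,
  `γ²β′ < 1`, `SmallnessFor`): by (2.6) along the run (`HistoryFlow.flowIneqs_of_run`), `g_K(s) ≤ (1+β₀)·g_K(K) = (1+β₀)·g`,
  so `le_log_inv_sq_along_of_coupling` — `x + 2·log(1+β₀) ≤ log g⁻²` ⇒ `x ≤ log g_K(s)⁻²`; under `β₀ ≤ ½` the margin
  `1` suffices (`2·log(3∕2) < 1`): `le_log_inv_sq_along_of_coupling_half`, i.e. from `g ≤ e^{−(x+1)∕2}`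
  (`HistoryFlow.le_log_inv_sq_of_le_exp`); `profile_ge_along_of_coupling_half`.
* §3 THE LEVEL: for every `θ > 0`, `A₀ > 0`, `p₀ ≥ 1` and target `Θ`, the explicit `x := max 1 (Θ ∕ (θ·A₀))` has
  `Θ ≤ θ·(A₀·x^{p₀})` (`le_theta_mul_level`), `1 ≤ x`.
* §4 IN THE LETTERS OF S12j: `hP_of_window` ∕ `hP_of_coupling` — the binder `hP` VERBATIM at `P := C.A₀·x^{C.p₀}` from
  `ThresholdOK` + tuning + `γ ≤ e^{−x∕2}` (resp. + the flow side + `β₀ ≤ ½` + `x + 1 ≤ log g⁻²`); `hθJ_of_level` — the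
  companion `Θ ≤ θ·(C.A₀·x_θ^{C.p₀})` at `x_θ := max 1 (Θ∕(θ·C.A₀))` (`1 ≤ C.p₀` from `ThresholdOK.rq_lt`); `one_le_levelP`.
  UPSHOT (R-OWNER-23-10 (2)(d)): for EVERY positive slack `θ` the pair (`hP`, `hθJ`) of the repaired END is inhabited on
  the window `γ ≤ min (…) (e^{−x_θ∕2})` (route §1) or for couplings `g ≤ min 1 (e^{−(max x₀ (x_θ+1))∕2})` (route §2) — the
  demand sits in the `ForSmallCouplings` prefix (`∃ γ₁ > 0, ∀ γ ≤ γ₁, ∃ g₁ > 0, ∀ g ≤ g₁, …`), NOT on print's O(1)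
  constants.

HONEST.  Flow-side bookkeeping over displayed binders (tuning; the β-box bounds are BetaPertH's content, displayed);
it discharges the NEW display `hP` of OUR repair into the coupling window and proves no estimate of Bałaban's; nothing of
H3 ∕ (B) ∕ BetaPertH ∕ NE7c ∕ NE7 ∕ the four rates is discharged; NE7b NOT proved; spine PROVED 0∕9.  HONEST DEPENDENCY
(cell): continuum YM on T⁴ ⇐ BetaPertH ∧ nine spine estimates (0/9 proved); BetaPertH ⇐ (D1) ∧ (D4) ∧ CAP+tail; G-an2-4
gates asym, D1 and NE2/3/4.  Unchanged here.
-/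

open Literature.MathematicalPhysics.QuantumFieldTheory.Balaban1983to89
open T4Continuum
open Summit.QuantumFields.BalabanUV.T4Continuum.CountThresholdUniform
open Summit.QuantumFields.BalabanUV.T4Continuum.HistoryFlow

namespace Summit.QuantumFields.BalabanUV.T4Continuum.HistoryFlowProfileLevel

noncomputable section

variable {F : T4Family} {G : Type*} [GaugeGroup G] [MeasurableSpace G] [HaarData G]

/-! ## §1 The window route: `γ ≤ e^{−x∕2}` ⇒ `x ≤ log g_K(s)⁻²` along every tuned run -/

section Window

/-- **ALONG A TUNED RUN EVERY COUPLING IS IN THE WINDOW**, so a window below `e^{−x∕2}` puts `x` below `log g_K(s)⁻²` at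
EVERY scale `s ≤ K` of EVERY run (tuning's `InInterval` clause + `HistoryFlow.le_log_inv_sq_of_le_exp`). [folklore] -/
theorem le_log_inv_sq_along_of_window (D : FiniteEpsData F G) {γ g x : ℝ} {g₀ : ℕ → ℝ} (ht : D.Tuned γ g g₀)
    (hγx : γ ≤ Real.exp (-(x / 2))) (K s : ℕ) (hs : s ≤ K) :
    x ≤ Real.log (((D.C ⟨K, F.m, g₀ K⟩).flow.g s) ^ 2)⁻¹ :=
  le_log_inv_sq_of_le_exp ((ht K).1 s hs).1 (((ht K).1 s hs).2.trans hγx)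

/-- **THE PROFILE LEVEL FROM THE WINDOW**: `A₀·x^{p₀} ≤ p₀(g_K(s)) = A₀·(log g_K(s)⁻²)^{p₀}` along every tuned run in a
window `γ ≤ e^{−x∕2}` (`0 ≤ A₀`, `0 ≤ x`). [folklore] -/
theorem profile_ge_along_of_window (D : FiniteEpsData F G) {γ g x A₀ : ℝ} {g₀ : ℕ → ℝ} (hA₀ : 0 ≤ A₀) (hx : 0 ≤ x)
    (ht : D.Tuned γ g g₀) (hγx : γ ≤ Real.exp (-(x / 2))) (p₀ K s : ℕ) (hs : s ≤ K) :
    A₀ * x ^ p₀ ≤ p0Profile A₀ p₀ ((D.C ⟨K, F.m, g₀ K⟩).flow.g s) := by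
  unfold p0Profile
  exact mul_le_mul_of_nonneg_left
    (pow_le_pow_left₀ hx (le_log_inv_sq_along_of_window D ht hγx K s hs) p₀) hA₀

end Window

/-! ## §2 The renormalised-coupling route: (2.6) along the run ⇒ `g_K(s) ≤ (1+β₀)·g` -/

section Coupling

/-- **(2.6) ALONG A TUNED RUN BOUNDS EVERY COUPLING BY THE RENORMALISED ONE**: `g_K(s) ≤ (1+β₀)·g` for `s ≤ K`
(`HistoryFlow.flowIneqs_of_run` — (2.6) from forward generation + the β-box bounds + `SmallnessFor` — and `g_K(K) = g`).
[folklore] -/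
theorem coupling_le_along_of_tuned (D : FiniteEpsData F G) {γ₀ γ b β' β₀ g : ℝ} {p : ℕ} (hb : 0 ≤ b)
    (hlo : FlowStep.BetaLowerH b γ₀ D.βfun) (hhi : FlowStep.BetaUpperH β' γ₀ D.βfun) (hγ : γ ≤ γ₀)
    (hγβ : γ ^ 2 * β' < 1) (S : B14FlowStep.SmallnessFor γ β' β₀ F.L p) (hβ₀ : 0 ≤ β₀)
    {g₀ : ℕ → ℝ} (ht : D.Tuned γ g g₀) (K s : ℕ) (hs : s ≤ K) :
    (D.C ⟨K, F.m, g₀ K⟩).flow.g s ≤ (1 + β₀) * g := by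
  rcases Nat.lt_or_ge s K with hsK | hKs
  · obtain ⟨Rr, hRr⟩ := exists_sizes (two_le_L F) p fun K s => (D.C ⟨K, F.m, g₀ K⟩).flow.g s
    have h26 := (flowIneqs_of_run (C := D.C.toB12) (β := D.βfun) D.curries D.fwd hb hlo hhi hγ hγβ S ⟨K, F.m, g₀ K⟩
      (ht K).1 (Rr K) fun j _ => hRr K j).1
    have hK : (D.C.toB12 ⟨K, F.m, g₀ K⟩).flow.g K = g := (ht K).2
    have := (h26 s K hsK le_rfl).2
    rw [hK] at this
    exact this
  · have hsK : s = K := le_antisymm hs hKs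
    subst hsK
    rw [(ht s).2]
    have hg : 0 < g := by rw [← (ht s).2]; exact ((ht s).1 s le_rfl).1
    nlinarith

/-- **THE RENORMALISED-COUPLING ROUTE**: `x + 2·log(1+β₀) ≤ log g⁻²` ⇒ `x ≤ log g_K(s)⁻²` at every scale `s ≤ K` of
every tuned run (by `g_K(s) ≤ (1+β₀)·g`). [folklore] -/
theorem le_log_inv_sq_along_of_coupling (D : FiniteEpsData F G) {γ₀ γ b β' β₀ g x : ℝ} {p : ℕ} (hb : 0 ≤ b)
    (hlo : FlowStep.BetaLowerH b γ₀ D.βfun) (hhi : FlowStep.BetaUpperH β' γ₀ D.βfun) (hγ : γ ≤ γ₀)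
    (hγβ : γ ^ 2 * β' < 1) (S : B14FlowStep.SmallnessFor γ β' β₀ F.L p) (hβ₀ : 0 ≤ β₀)
    {g₀ : ℕ → ℝ} (ht : D.Tuned γ g g₀) (hx : x + 2 * Real.log (1 + β₀) ≤ Real.log (g ^ 2)⁻¹) (K s : ℕ)
    (hs : s ≤ K) : x ≤ Real.log (((D.C ⟨K, F.m, g₀ K⟩).flow.g s) ^ 2)⁻¹ := by
  have hgs : 0 < (D.C ⟨K, F.m, g₀ K⟩).flow.g s := ((ht K).1 s hs).1
  have hle := coupling_le_along_of_tuned D hb hlo hhi hγ hγβ S hβ₀ ht K s hs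
  have hg : 0 < g := by rw [← (ht K).2]; exact ((ht K).1 K le_rfl).1
  have hmono := B14FlowStep.log_inv_sq_mono hgs hle
  have hsplit : Real.log (((1 + β₀) * g) ^ 2)⁻¹ = Real.log (g ^ 2)⁻¹ - 2 * Real.log (1 + β₀) := by
    rw [B14FlowStep.log_inv_sq, B14FlowStep.log_inv_sq, Real.log_mul (by positivity) hg.ne']
    ring
  linarith

/-- `2·log(3∕2) < 1`, so under `β₀ ≤ ½` the margin `1` suffices. [folklore] -/
theorem two_mul_log_one_add_le_one {β₀ : ℝ} (hβ₀ : 0 ≤ β₀) (hβ : β₀ ≤ 1 / 2) : 2 * Real.log (1 + β₀) ≤ 1 := by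
  have h1 : Real.log (1 + β₀) ≤ (1 + β₀) - 1 := Real.log_le_sub_one_of_pos (by linarith)
  linarith

/-- **THE RENORMALISED-COUPLING ROUTE UNDER `β₀ ≤ ½`**: `x + 1 ≤ log g⁻²` ⇒ `x ≤ log g_K(s)⁻²` along every tuned run.
[folklore] -/
theorem le_log_inv_sq_along_of_coupling_half (D : FiniteEpsData F G) {γ₀ γ b β' β₀ g x : ℝ} {p : ℕ} (hb : 0 ≤ b)
    (hlo : FlowStep.BetaLowerH b γ₀ D.βfun) (hhi : FlowStep.BetaUpperH β' γ₀ D.βfun) (hγ : γ ≤ γ₀)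
    (hγβ : γ ^ 2 * β' < 1) (S : B14FlowStep.SmallnessFor γ β' β₀ F.L p) (hβ₀ : 0 ≤ β₀) (hβ : β₀ ≤ 1 / 2)
    {g₀ : ℕ → ℝ} (ht : D.Tuned γ g g₀) (hx : x + 1 ≤ Real.log (g ^ 2)⁻¹) (K s : ℕ) (hs : s ≤ K) :
    x ≤ Real.log (((D.C ⟨K, F.m, g₀ K⟩).flow.g s) ^ 2)⁻¹ :=
  le_log_inv_sq_along_of_coupling D hb hlo hhi hγ hγβ S hβ₀ ht
    (by have := two_mul_log_one_add_le_one hβ₀ hβ; linarith) K s hs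

/-- … packaged with `HistoryFlow.le_log_inv_sq_of_le_exp`: `0 < g ≤ e^{−(x+1)∕2}` ⇒ `x ≤ log g_K(s)⁻²`. [folklore] -/
theorem le_log_inv_sq_along_of_le_exp (D : FiniteEpsData F G) {γ₀ γ b β' β₀ g x : ℝ} {p : ℕ} (hb : 0 ≤ b)
    (hlo : FlowStep.BetaLowerH b γ₀ D.βfun) (hhi : FlowStep.BetaUpperH β' γ₀ D.βfun) (hγ : γ ≤ γ₀)
    (hγβ : γ ^ 2 * β' < 1) (S : B14FlowStep.SmallnessFor γ β' β₀ F.L p) (hβ₀ : 0 ≤ β₀) (hβ : β₀ ≤ 1 / 2)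
    {g₀ : ℕ → ℝ} (ht : D.Tuned γ g g₀) (hg : 0 < g) (hle : g ≤ Real.exp (-((x + 1) / 2))) (K s : ℕ)
    (hs : s ≤ K) : x ≤ Real.log (((D.C ⟨K, F.m, g₀ K⟩).flow.g s) ^ 2)⁻¹ :=
  le_log_inv_sq_along_of_coupling_half D hb hlo hhi hγ hγβ S hβ₀ hβ ht (le_log_inv_sq_of_le_exp hg hle) K s hs

/-- **THE PROFILE LEVEL FROM THE RENORMALISED COUPLING** (`β₀ ≤ ½`): `x + 1 ≤ log g⁻²` ⇒ `A₀·x^{p₀} ≤ p₀(g_K(s))`.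
[folklore] -/
theorem profile_ge_along_of_coupling_half (D : FiniteEpsData F G) {γ₀ γ b β' β₀ g x A₀ : ℝ} {p : ℕ} (hb : 0 ≤ b)
    (hlo : FlowStep.BetaLowerH b γ₀ D.βfun) (hhi : FlowStep.BetaUpperH β' γ₀ D.βfun) (hγ : γ ≤ γ₀)
    (hγβ : γ ^ 2 * β' < 1) (S : B14FlowStep.SmallnessFor γ β' β₀ F.L p) (hβ₀ : 0 ≤ β₀) (hβ : β₀ ≤ 1 / 2)
    {g₀ : ℕ → ℝ} (ht : D.Tuned γ g g₀) (hA₀ : 0 ≤ A₀) (hx0 : 0 ≤ x) (hx : x + 1 ≤ Real.log (g ^ 2)⁻¹)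
    (p₀ K s : ℕ) (hs : s ≤ K) : A₀ * x ^ p₀ ≤ p0Profile A₀ p₀ ((D.C ⟨K, F.m, g₀ K⟩).flow.g s) := by
  unfold p0Profile
  exact mul_le_mul_of_nonneg_left
    (pow_le_pow_left₀ hx0 (le_log_inv_sq_along_of_coupling_half D hb hlo hhi hγ hγβ S hβ₀ hβ ht hx K s hs) p₀) hA₀

end Coupling

/-! ## §3 The level paying a class-linear constant `Θ` out of a slack `θ` -/

section Level

/-- `1 ≤ max 1 (Θ ∕ (θ·A₀))`. [folklore] -/
theorem one_le_level (θ A₀ Θ : ℝ) : 1 ≤ max 1 (Θ / (θ * A₀)) := le_max_left _ _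

/-- **THE LEVEL**: for `θ > 0`, `A₀ > 0`, `p₀ ≥ 1`, the explicit `x := max 1 (Θ ∕ (θ·A₀))` satisfies
`Θ ≤ θ·(A₀·x^{p₀})` — ANY positive slack pays ANY class-linear constant at a high enough profile level. [folklore] -/
theorem le_theta_mul_level {θ A₀ : ℝ} (hθ : 0 < θ) (hA₀ : 0 < A₀) {p₀ : ℕ} (hp₀ : 1 ≤ p₀) (Θ : ℝ) :
    Θ ≤ θ * (A₀ * (max 1 (Θ / (θ * A₀))) ^ p₀) := by
  set x := max 1 (Θ / (θ * A₀)) with hxdef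
  have hx1 : 1 ≤ x := le_max_left _ _
  have hxp : x ≤ x ^ p₀ := by
    calc x = x ^ 1 := (pow_one x).symm
      _ ≤ x ^ p₀ := pow_le_pow_right₀ hx1 hp₀
  have hθA : 0 < θ * A₀ := mul_pos hθ hA₀
  have h1 : Θ ≤ θ * A₀ * x := by
    have : Θ / (θ * A₀) ≤ x := le_max_right _ _
    rwa [div_le_iff₀ hθA, mul_comm] at this
  calc Θ ≤ θ * A₀ * x := h1
    _ ≤ θ * A₀ * x ^ p₀ := mul_le_mul_of_nonneg_left hxp hθA.le
    _ = θ * (A₀ * x ^ p₀) := by ring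

/-- the level is nonnegative [folklore] -/
theorem level_nonneg (θ A₀ Θ : ℝ) : 0 ≤ max 1 (Θ / (θ * A₀)) := zero_le_one.trans (one_le_level θ A₀ Θ)

/-- the window at the level is a positive number [folklore] -/
theorem exp_neg_half_pos (x : ℝ) : 0 < Real.exp (-(x / 2)) := Real.exp_pos _

end Level

/-! ## §4 In the letters of the repair row S12j -/

section Letters

variable {C : T4PrintedShapeBanking.Consts} {rr : ℕ} {β₀ : ℝ}

/-- `1 ≤ C.p₀` under `ThresholdOK` (`r·(q′+1) < p₀`). [folklore] -/
theorem one_le_p₀ {L : ℕ} (h : ThresholdOK C L rr β₀) : 1 ≤ C.p₀ := by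
  have := h.rq_lt; omega

/-- `1 ≤ P := C.A₀·x^{C.p₀}` for `1 ≤ C.A₀`, `1 ≤ x`. [folklore] -/
theorem one_le_levelP (hA₀ : 1 ≤ C.A₀) {x : ℝ} (hx : 1 ≤ x) : 1 ≤ C.A₀ * x ^ C.p₀ :=
  one_le_mul_of_one_le_of_one_le hA₀ (one_le_pow₀ hx)

/-- **`hP` FROM THE WINDOW** — the S12j binder `∀ K ≥ K₀, ∀ s ≤ K, P ≤ p0Profile C.A₀ C.p₀ (g_K s)` VERBATIM at
`P := C.A₀·x^{C.p₀}`, from `ThresholdOK` (for `0 < C.A₀`), tuning and a window `γ ≤ e^{−x∕2}` (`0 ≤ x`); no flow side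
needed. [folklore] -/
theorem hP_of_window (D : FiniteEpsData F G) (h : ThresholdOK C F.L rr β₀) {γ g x : ℝ} {g₀ : ℕ → ℝ}
    (ht : D.Tuned γ g g₀) (hx : 0 ≤ x) (hγx : γ ≤ Real.exp (-(x / 2))) (K₀ : ℕ) :
    ∀ K, K₀ ≤ K → ∀ s ≤ K, C.A₀ * x ^ C.p₀ ≤ p0Profile C.A₀ C.p₀ ((D.C ⟨K, F.m, g₀ K⟩).flow.g s) :=
  fun K _ s hs => profile_ge_along_of_window D h.A₀_pos.le hx ht hγx C.p₀ K s hs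

/-- **`hP` FROM THE RENORMALISED COUPLING** — the same binder from the flow side (β-box bounds, `γ ≤ γ₀`, `γ²β′ < 1`,
`SmallnessFor`), `β₀ ≤ ½`, tuning and `x + 1 ≤ log g⁻²` (e.g. `g ≤ e^{−(x+1)∕2}`). [folklore] -/
theorem hP_of_coupling (D : FiniteEpsData F G) (h : ThresholdOK C F.L rr β₀) {γ₀ γ b β' g x : ℝ} {p : ℕ}
    (hb : 0 ≤ b) (hlo : FlowStep.BetaLowerH b γ₀ D.βfun) (hhi : FlowStep.BetaUpperH β' γ₀ D.βfun) (hγ : γ ≤ γ₀)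
    (hγβ : γ ^ 2 * β' < 1) (S : B14FlowStep.SmallnessFor γ β' β₀ F.L p) (hβ : β₀ ≤ 1 / 2) {g₀ : ℕ → ℝ}
    (ht : D.Tuned γ g g₀) (hx0 : 0 ≤ x) (hx : x + 1 ≤ Real.log (g ^ 2)⁻¹) (K₀ : ℕ) :
    ∀ K, K₀ ≤ K → ∀ s ≤ K, C.A₀ * x ^ C.p₀ ≤ p0Profile C.A₀ C.p₀ ((D.C ⟨K, F.m, g₀ K⟩).flow.g s) :=
  fun K _ s hs => profile_ge_along_of_coupling_half D hb hlo hhi hγ hγβ S h.β₀_nonneg hβ ht h.A₀_pos.le hx0 hx C.p₀ K s hs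

/-- **`hθJ` AT THE LEVEL** — the companion binder `Θ ≤ θ·P` of the repaired junction at `P := C.A₀·x_θ^{C.p₀}`,
`x_θ := max 1 (Θ ∕ (θ·C.A₀))`, for EVERY `θ > 0` and EVERY `Θ` (in S12j: `Θ := ΘJ d sS θc + 8·2^d·log(2d+1)`).
[folklore] -/
theorem hθJ_of_level (h : ThresholdOK C F.L rr β₀) {θ : ℝ} (hθ : 0 < θ) (Θ : ℝ) :
    Θ ≤ θ * (C.A₀ * (max 1 (Θ / (θ * C.A₀))) ^ C.p₀) :=
  le_theta_mul_level hθ h.A₀_pos (one_le_p₀ h) Θ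

/-- **THE PAIR (`hP`, `hθJ`) INHABITED ON A WINDOW, FOR EVERY POSITIVE SLACK** — R-OWNER-23-10 (2)(d) in one
statement: given `ThresholdOK`, `1 ≤ C.A₀`, any `θ > 0` and any `Θ`, the level `x_θ := max 1 (Θ∕(θ·C.A₀))` and
`P := C.A₀·x_θ^{C.p₀}` have `1 ≤ P`, `Θ ≤ θ·P`, and along EVERY sequence of runs tuned inside a window
`γ ≤ e^{−x_θ∕2}` the profile dominates `P` at every scale of every run. [folklore] -/
theorem thresholdPaid_of_window (D : FiniteEpsData F G) (h : ThresholdOK C F.L rr β₀) (hA₀ : 1 ≤ C.A₀) {θ : ℝ}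
    (hθ : 0 < θ) (Θ : ℝ) {γ g : ℝ} {g₀ : ℕ → ℝ} (ht : D.Tuned γ g g₀)
    (hγx : γ ≤ Real.exp (-(max 1 (Θ / (θ * C.A₀)) / 2))) (K₀ : ℕ) :
    1 ≤ C.A₀ * (max 1 (Θ / (θ * C.A₀))) ^ C.p₀ ∧
      Θ ≤ θ * (C.A₀ * (max 1 (Θ / (θ * C.A₀))) ^ C.p₀) ∧
      ∀ K, K₀ ≤ K → ∀ s ≤ K,
        C.A₀ * (max 1 (Θ / (θ * C.A₀))) ^ C.p₀ ≤ p0Profile C.A₀ C.p₀ ((D.C ⟨K, F.m, g₀ K⟩).flow.g s) :=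
  ⟨one_le_levelP hA₀ (one_le_level θ C.A₀ Θ), hθJ_of_level h hθ Θ,
    hP_of_window D h ht (level_nonneg θ C.A₀ Θ) hγx K₀⟩

/-- **THE PAIR (`hP`, `hθJ`) INHABITED BELOW A RENORMALISED-COUPLING THRESHOLD, FOR EVERY POSITIVE SLACK** — the same
with the demand on the renormalised coupling `g ≤ e^{−(x_θ+1)∕2}` instead of on the window (route §2: the flow side the
ENDs hold, `β₀ ≤ ½`). [folklore] -/
theorem thresholdPaid_of_coupling (D : FiniteEpsData F G) (h : ThresholdOK C F.L rr β₀) (hA₀ : 1 ≤ C.A₀) {θ : ℝ}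
    (hθ : 0 < θ) (Θ : ℝ) {γ₀ γ b β' g : ℝ} {p : ℕ} (hb : 0 ≤ b) (hlo : FlowStep.BetaLowerH b γ₀ D.βfun)
    (hhi : FlowStep.BetaUpperH β' γ₀ D.βfun) (hγ : γ ≤ γ₀) (hγβ : γ ^ 2 * β' < 1)
    (S : B14FlowStep.SmallnessFor γ β' β₀ F.L p) (hβ : β₀ ≤ 1 / 2) {g₀ : ℕ → ℝ} (ht : D.Tuned γ g g₀) (hg : 0 < g)
    (hle : g ≤ Real.exp (-((max 1 (Θ / (θ * C.A₀)) + 1) / 2))) (K₀ : ℕ) :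
    1 ≤ C.A₀ * (max 1 (Θ / (θ * C.A₀))) ^ C.p₀ ∧
      Θ ≤ θ * (C.A₀ * (max 1 (Θ / (θ * C.A₀))) ^ C.p₀) ∧
      ∀ K, K₀ ≤ K → ∀ s ≤ K,
        C.A₀ * (max 1 (Θ / (θ * C.A₀))) ^ C.p₀ ≤ p0Profile C.A₀ C.p₀ ((D.C ⟨K, F.m, g₀ K⟩).flow.g s) :=
  ⟨one_le_levelP hA₀ (one_le_level θ C.A₀ Θ), hθJ_of_level h hθ Θ,
    hP_of_coupling D h hb hlo hhi hγ hγβ S hβ ht (level_nonneg θ C.A₀ Θ) (le_log_inv_sq_of_le_exp hg hle) K₀⟩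

end Letters

end

end Summit.QuantumFields.BalabanUV.T4Continuum.HistoryFlowProfileLevel
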